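import Summits.QuantumFields.BalabanUV.T4Continuum.Support.NE7K1LinWalkLineWalk

/-!
# NE7K1LinWalkLineThreshold — row NE7 (node U5), candidate route HOM, path H1L, cell K1-lin(s): AN EXPLICIT CUBE-SCALE THRESHOLD
# `M₀(d,L,a)` FOR THE TWO-CUTOFF LINE's WALK — `τ♮(d,L,M,a) ≤ C♮(d,L,a)∕M` for `M ≥ 1`, hence `3^{d+1}·τ♮ < 1` as soon as
# `M > 3^{d+1}·C♮(d,L,a)`, one closed-form `M₀` for every `s ∈ [0,1]` and every mesh

Lineage `b2b-balaban-t4-ne7-p2` (CRUX PROVER NE7 #2), generation 69; series (RW) file 16 (a corollary file), over `NE7K1LinWalkLineWalk`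
(file 14: `lineAlpha2`, `lineBeta2`, `lineSigma`, `lineTau`, the smallness hypothesis `3^{d+1}·lineTau < 1` of `hasSum_extLine_walk` ∕
`twoCutoffLine_inv_entry_decay`).  The desk's KILL (xx-L) [L4] asks for «ONE displayed smallness … and an explicit `M₀(d,a,L)`»; here it is:

* `lineAlpha2_le`, `lineBeta2_le` — for `M ≥ 1`: `α♮ = 384(d+1)(1+L³)∕M²` and
  `β♮ ≤ (6144(d+1)²(1+L²) + 192a²(d+1)² + 8192(d+1)⁴L⁴(L^{−(d+1)}+1))∕M²` (`1∕M⁴ ≤ 1∕M²`);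
* **`lineTau_le`** — `τ♮(d,L,M,a) ≤ √(384(d+1)(1+L³)∕σ′ + (6144(d+1)²(1+L²) + 192a²(d+1)² + 8192(d+1)⁴L⁴(L^{−(d+1)}+1))∕σ′²) ∕ M`,
  `σ′ = min(lineSigma d L a, 1)` — the numerator `C♮(d,L,a)` is FREE OF `M`, of `s` and of the mesh;
* **`lineTau_small_of_lt`** — `3^{d+1}·C♮(d,L,a) < M ⇒ 3^{d+1}·τ♮(d,L,M,a) < 1`: the EXPLICIT `M₀(d,L,a) = 3^{d+1}·C♮(d,L,a)` beyond which
  file 14's expansion converges and file 15's box decay holds, for every `s ∈ [0,1]`.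

HONEST FRAMING: [folklore] real arithmetic on displayed constants; crude (not optimised; cf. the static table minimal `M` = 2674 ∕ 58315 ∕ 746591
∕ 7738707 at `a = 1`, `L = 2`, `d+1 = 1…4`); nothing of Bałaban's asserted; no `sorry`.  Census only; NO letter ∕ tag ∕ size of NE7 moves;
NE7 NOT PRINTED ∕ NOT PROVED; spine 0∕9; FIXED FINITE T⁴, rung (B)+1; NOT infinite volume, NOT mass gap, NOT Clay.  HONEST DEPENDENCY: continuum
YM on T⁴ ⇐ BetaPertH ∧ nine spine estimates (0/9 proved); BetaPertH ⇐ (D1) ∧ (D4) ∧ CAP+tail; G-an2-4 gates asym, D1 and NE2/3/4.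
-/

noncomputable section

namespace Summit.QuantumFields.BalabanUV.T4Continuum.NE7K1LinWalkLineThreshold

open NE7K1LinWalkLineWalk

variable {d L M : ℕ} [NeZero L] {a : ℝ}

omit [NeZero L] in
/-- `α♮ = 384(d+1)(1+L³)∕M²` (the defining equation, for rewriting). [folklore] -/
theorem lineAlpha2_le : lineAlpha2 d L M = 384 * ((d : ℝ) + 1) * (1 + (L : ℝ) ^ 3) / (M : ℝ) ^ 2 := rfl

/-- for `M ≥ 1`: `β♮ ≤ (6144(d+1)²(1+L²) + 192a²(d+1)² + 8192(d+1)⁴L⁴(L^{−(d+1)}+1))∕M²` (`1∕M⁴ ≤ 1∕M²`). [folklore] -/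
theorem lineBeta2_le (hM : 1 ≤ M) (a : ℝ) :
    lineBeta2 d L M a ≤ (6144 * ((d : ℝ) + 1) ^ 2 * (1 + (L : ℝ) ^ 2) + 192 * a ^ 2 * ((d : ℝ) + 1) ^ 2 +
      8192 * ((d : ℝ) + 1) ^ 4 * (L : ℝ) ^ 4 * (1 / (L : ℝ) ^ (d + 1) + 1)) / (M : ℝ) ^ 2 := by
  have hM1 : (1 : ℝ) ≤ M := by exact_mod_cast hM
  have hM0 : (0 : ℝ) < M := by linarith
  have hL0 : (0 : ℝ) < L := by exact_mod_cast (NeZero.one_le : 1 ≤ L)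
  rw [lineBeta2, add_div, add_div]
  have h1 : 6144 * ((d : ℝ) + 1) ^ 2 * (1 + (L : ℝ) ^ 2) / (M : ℝ) ^ 4 ≤ 6144 * ((d : ℝ) + 1) ^ 2 * (1 + (L : ℝ) ^ 2) / (M : ℝ) ^ 2 := by
    apply div_le_div_of_nonneg_left (by positivity) (by positivity)
    have : (M : ℝ) ^ 2 ≤ (M : ℝ) ^ 4 := pow_le_pow_right₀ hM1 (by norm_num)
    exact this
  linarith

omit [NeZero L] in
/-- `τ♮ = √(α♮∕σ′ + β♮∕σ′²)`, unfolded. [folklore] -/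
theorem lineTau_eq (a : ℝ) : lineTau d L M a =
    Real.sqrt (lineAlpha2 d L M / min (lineSigma d L a) 1 + lineBeta2 d L M a / (min (lineSigma d L a) 1) ^ 2) := rfl

/-- **THE WALK PARAMETER DECAYS LIKE `1∕M`**: for `M ≥ 1` and `a > 0`,
`τ♮(d,L,M,a) ≤ √(384(d+1)(1+L³)∕σ′ + (6144(d+1)²(1+L²) + 192a²(d+1)² + 8192(d+1)⁴L⁴(L^{−(d+1)}+1))∕σ′²) ∕ M`, `σ′ = min(σ♮,1)` — the
numerator is free of `M`, of `s` and of the mesh. [folklore] -/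
theorem lineTau_le (hM : 1 ≤ M) (ha : 0 < a) :
    lineTau d L M a ≤ Real.sqrt (384 * ((d : ℝ) + 1) * (1 + (L : ℝ) ^ 3) / min (lineSigma d L a) 1 +
      (6144 * ((d : ℝ) + 1) ^ 2 * (1 + (L : ℝ) ^ 2) + 192 * a ^ 2 * ((d : ℝ) + 1) ^ 2 +
        8192 * ((d : ℝ) + 1) ^ 4 * (L : ℝ) ^ 4 * (1 / (L : ℝ) ^ (d + 1) + 1)) / (min (lineSigma d L a) 1) ^ 2) / M := by
  have hM1 : (1 : ℝ) ≤ M := by exact_mod_cast hM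
  have hM0 : (0 : ℝ) < M := by linarith
  have hL0 : (0 : ℝ) < L := by exact_mod_cast (NeZero.one_le : 1 ≤ L)
  have hσ : 0 < min (lineSigma d L a) 1 := lt_min (lineSigma_pos ha) one_pos
  set σ' := min (lineSigma d L a) 1 with hσ'
  set A : ℝ := 384 * ((d : ℝ) + 1) * (1 + (L : ℝ) ^ 3) with hA
  set B : ℝ := 6144 * ((d : ℝ) + 1) ^ 2 * (1 + (L : ℝ) ^ 2) + 192 * a ^ 2 * ((d : ℝ) + 1) ^ 2 +
    8192 * ((d : ℝ) + 1) ^ 4 * (L : ℝ) ^ 4 * (1 / (L : ℝ) ^ (d + 1) + 1) with hB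
  have hA0 : 0 ≤ A := by positivity
  have hB0 : 0 ≤ B := by positivity
  -- the radicand is at most `(A∕σ′ + B∕σ′²)∕M²`
  have hrad : lineAlpha2 d L M / σ' + lineBeta2 d L M a / σ' ^ 2 ≤ (A / σ' + B / σ' ^ 2) / (M : ℝ) ^ 2 := by
    have h1 : lineAlpha2 d L M / σ' = (A / σ') / (M : ℝ) ^ 2 := by
      rw [lineAlpha2_le, hA]
      field_simp
    have h2 : lineBeta2 d L M a / σ' ^ 2 ≤ (B / σ' ^ 2) / (M : ℝ) ^ 2 := by
      have hb := lineBeta2_le (d := d) (L := L) hM a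
      rw [← hB] at hb
      calc lineBeta2 d L M a / σ' ^ 2 ≤ (B / (M : ℝ) ^ 2) / σ' ^ 2 := div_le_div_of_nonneg_right hb (by positivity)
        _ = (B / σ' ^ 2) / (M : ℝ) ^ 2 := by rw [div_div, div_div, mul_comm]
    rw [h1, add_div]
    linarith
  rw [lineTau_eq, ← hσ']
  calc Real.sqrt (lineAlpha2 d L M / σ' + lineBeta2 d L M a / σ' ^ 2)
      ≤ Real.sqrt ((A / σ' + B / σ' ^ 2) / (M : ℝ) ^ 2) := Real.sqrt_le_sqrt hrad
    _ = Real.sqrt (A / σ' + B / σ' ^ 2) / M := by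
        rw [Real.sqrt_div' _ (by positivity : (0 : ℝ) ≤ (M : ℝ) ^ 2), Real.sqrt_sq hM0.le]

/-- **AN EXPLICIT THRESHOLD `M₀(d,L,a)`**: if `3^{d+1}·C♮(d,L,a) < M` with
`C♮ = √(384(d+1)(1+L³)∕σ′ + (6144(d+1)²(1+L²) + 192a²(d+1)² + 8192(d+1)⁴L⁴(L^{−(d+1)}+1))∕σ′²)`, then `3^{d+1}·τ♮(d,L,M,a) < 1` — the
smallness hypothesis of `NE7K1LinWalkLineWalk.hasSum_extLine_walk` ∕ `twoCutoffLine_inv_entry_decay` and of `NE7K1LinWalkLineBox`, met by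
ONE closed-form `M₀` for every `s ∈ [0,1]` and every mesh. [folklore] -/
theorem lineTau_small_of_lt (hM : 1 ≤ M) (ha : 0 < a)
    (hlt : (3 : ℝ) ^ (d + 1) * Real.sqrt (384 * ((d : ℝ) + 1) * (1 + (L : ℝ) ^ 3) / min (lineSigma d L a) 1 +
      (6144 * ((d : ℝ) + 1) ^ 2 * (1 + (L : ℝ) ^ 2) + 192 * a ^ 2 * ((d : ℝ) + 1) ^ 2 +
        8192 * ((d : ℝ) + 1) ^ 4 * (L : ℝ) ^ 4 * (1 / (L : ℝ) ^ (d + 1) + 1)) / (min (lineSigma d L a) 1) ^ 2) < M) :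
    (3 : ℝ) ^ (d + 1) * lineTau d L M a < 1 := by
  have hM1 : (1 : ℝ) ≤ M := by exact_mod_cast hM
  have hM0 : (0 : ℝ) < M := by linarith
  have h := lineTau_le (d := d) (L := L) hM ha
  have h3 : (0 : ℝ) ≤ (3 : ℝ) ^ (d + 1) := by positivity
  calc (3 : ℝ) ^ (d + 1) * lineTau d L M a
      ≤ (3 : ℝ) ^ (d + 1) * (Real.sqrt (384 * ((d : ℝ) + 1) * (1 + (L : ℝ) ^ 3) / min (lineSigma d L a) 1 +
          (6144 * ((d : ℝ) + 1) ^ 2 * (1 + (L : ℝ) ^ 2) + 192 * a ^ 2 * ((d : ℝ) + 1) ^ 2 +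
            8192 * ((d : ℝ) + 1) ^ 4 * (L : ℝ) ^ 4 * (1 / (L : ℝ) ^ (d + 1) + 1)) / (min (lineSigma d L a) 1) ^ 2) / M) :=
        mul_le_mul_of_nonneg_left h h3
    _ < 1 := by
        rw [← mul_div_assoc, div_lt_one hM0]
        exact hlt

/-- **NON-VACUITY IN KERNEL**: for every dimension `d+1`, refinement factor `L ≥ 1` and `a > 0` there IS a cube scale `M ≥ 3` with
`3^{d+1}·τ♮(d,L,M,a) < 1` — the smallness hypothesis of the two-cutoff line's walk expansion (`NE7K1LinWalkLineWalk.hasSum_extLine_walk`,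
`twoCutoffLine_inv_entry_decay`, `NE7K1LinWalkLineBox`) is met for `M` large, uniformly in `s ∈ [0,1]` and in the mesh (Archimedes on
`lineTau_small_of_lt`'s closed-form `M₀(d,L,a)`). [folklore] -/
theorem exists_cubeScale_small (d L : ℕ) [NeZero L] {a : ℝ} (ha : 0 < a) :
    ∃ M : ℕ, 3 ≤ M ∧ (3 : ℝ) ^ (d + 1) * lineTau d L M a < 1 := by
  obtain ⟨M, hM⟩ := exists_nat_gt ((3 : ℝ) ^ (d + 1) *
    Real.sqrt (384 * ((d : ℝ) + 1) * (1 + (L : ℝ) ^ 3) / min (lineSigma d L a) 1 +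
      (6144 * ((d : ℝ) + 1) ^ 2 * (1 + (L : ℝ) ^ 2) + 192 * a ^ 2 * ((d : ℝ) + 1) ^ 2 +
        8192 * ((d : ℝ) + 1) ^ 4 * (L : ℝ) ^ 4 * (1 / (L : ℝ) ^ (d + 1) + 1)) / (min (lineSigma d L a) 1) ^ 2))
  refine ⟨max M 3, le_max_right _ _, lineTau_small_of_lt (le_trans (by norm_num) (le_max_right _ _)) ha (hM.trans_le ?_)⟩
  exact_mod_cast le_max_left M 3

/-- **THE THRESHOLD IS MONOTONE**: once `3^{d+1}·C♮(d,L,a) < M₀`, every `M ≥ M₀` satisfies the smallness — one `M₀(d,L,a)` for the whole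
line and all larger cube scales. [folklore] -/
theorem lineTau_small_of_le {d L M₀ M : ℕ} [NeZero L] {a : ℝ} (hM₀ : 1 ≤ M₀) (ha : 0 < a)
    (hlt : (3 : ℝ) ^ (d + 1) * Real.sqrt (384 * ((d : ℝ) + 1) * (1 + (L : ℝ) ^ 3) / min (lineSigma d L a) 1 +
      (6144 * ((d : ℝ) + 1) ^ 2 * (1 + (L : ℝ) ^ 2) + 192 * a ^ 2 * ((d : ℝ) + 1) ^ 2 +
        8192 * ((d : ℝ) + 1) ^ 4 * (L : ℝ) ^ 4 * (1 / (L : ℝ) ^ (d + 1) + 1)) / (min (lineSigma d L a) 1) ^ 2) < M₀)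
    (hM : M₀ ≤ M) : (3 : ℝ) ^ (d + 1) * lineTau d L M a < 1 :=
  lineTau_small_of_lt (hM₀.trans hM) ha (hlt.trans_le (by exact_mod_cast hM))

end Summit.QuantumFields.BalabanUV.T4Continuum.NE7K1LinWalkLineThreshold

end
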